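import Literature.Analysis.FluidPDE.TorusNSSerrinCriterion
import Literature.Analysis.FluidPDE.TorusVorticityTensorTransport
import Literature.Analysis.FluidPDE.ExtremeGrowthVorticityControl
import Literature.Analysis.FluidPDE.TorusClassicalH1Balance
import Literature.Analysis.FluidPDE.TorusClassicalNSMaximalSolution
import HarnessLib

/-!
# The Chae–Lee geometric Prodi–Serrin criterion on `T³`: the positive part of
# `(u × ω/|ω|)·(−Δu/|Δu|)` in a Serrin class prevents blow-up

Analysis/FluidPDE proof file (theorems only; no definitions, no named facts).

search for candidate a priori estimates; no regularity claim (cell `pub-nsfunc`, literature seat: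
this file types a PUBLISHED conditional regularity criterion of the velocity–vorticity GEOMETRY
family; nothing new).

Source: D. Chae, J. Lee, *On the geometric regularity conditions for the 3D Navier–Stokes
equations*, Nonlinear Anal. 151 (2017) 265–273 (= arXiv:1606.08126), Theorem 1 and its proof (§2).
Printed (ℝ³; `Λ = (−Δ)^{1/2}`, `{f}₊ = max{f, 0}`, direction fields set to `0` where `ω = 0` or
`Λ^β v = 0`; `‖·‖_{L^{γ,α}_{x,t}} = ‖‖·‖_{L^γ_x}‖_{L^α_t}`):

"**Theorem 1.** Let `v` be a local in time regular solution of (NS) in `Q_T := ℝ³ × (0, T)` with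
`v₀ ∈ H^{1/2}(ℝ³)`. Then, (i) if … for an absolute constant `ε₀` and some `β ∈ [1, 2]`,
`‖{(v × ω/|ω|)·(Λ^β v/|Λ^β v|)}₊‖_{L^{3,∞}_{x,t}(Q_T)} ≤ ε₀`, then a regular solution `v` exists
beyond `T` …; (ii) `v` blows up at `T_*` … if and only if for all `γ ∈ (3, ∞]` and `α ∈ [2, ∞]`
with `3/γ + 2/α ≤ 1` and all `β ∈ [1, 2]`,
`‖{(v × ω/|ω|)·(Λ^β v/|Λ^β v|)}₊‖_{L^{γ,α}_{x,t}(Q_T)} = ∞`."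

Printed proof (§2, "standard a priori estimates"): `½ d/dt‖Λ^{β/2}v‖² + ‖∇Λ^{β/2}v‖² =
∫(v × ω)·Λ^β v ≤ ∫{(v × ω/|ω|)·(Λ^β v/|Λ^β v|)}₊ |ω| |Λ^β v| ≤ ‖{…}₊‖_{L^γ}‖ω‖_{L^p}‖Λ^β v‖_{L^q}`,
`1/γ + 1/p + 1/q = 1`, Gagliardo–Nirenberg, Young: `≤ C‖{…}₊‖^{2γ/(γ−3)}_{L^γ}‖Λ^{β/2}v‖² +
½‖∇Λ^{β/2}v‖²`, Grönwall; in case (i) `[1 − C‖{…}₊‖_{L³}]‖∇Λ^{β/2}v‖² ≥ 0`. Remark 2: "there are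
many physical flows, including Beltrami flows, for which the triple product vanishes".

This file types the case **`β = 2`** (`Λ²v = −Δv = ∇ × ω` for divergence-free `v`, the tree's
`Torus.curl_curl_eq_neg_laplacian_of_isDivFree`; the level of the ENSTROPHY) on the unit torus
`T^d`, `card d = 3`, in the tree's classical vocabulary and in CONTINUATION FORM at a putative
blow-up time, exactly as the tree's Serrin file `TorusNSSerrinCriterion` renders
`u ∈ L^α(0,T; L^γ)`: a continuous majorant `N(t) ≥ ‖κ(t)‖_{L^γ}` with bounded primitive
`∫₀ᵗ N^{2γ/(γ−3)} ≤ I` (`3/γ + 2/α = 1`), smallness at `γ = 3`, a pointwise bound at `γ = ∞`.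

* `ChaeLee2017.integral_inner_convect_laplacian_eq` — the rotation (Lamb-vector) form of the
  enstrophy production for smooth divergence-free `v`: `∫⟪(v·∇)v, Δv⟫ = ∫ (ω × v)·Δv`
  (frame-free: `∫ ∑ᵢⱼ vⱼ Wⱼᵢ (Δv)ᵢ`, `W = torusVorticityTensor`; the gradient part of
  `(v·∇)v = ω × v + ∇½|v|²` is orthogonal to the divergence-free `Δv`).
* `ChaeLee2017.sum_sum_le_posPart_mul` — the printed pointwise step at `β = 2`:
  `(v × ω)·(−Δv) ≤ κ |ω| |Δv|`, `κ := {(v × ω/|ω|)·(−Δv/|−Δv|)}₊` (Lean's `a/0 = 0` is the printed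
  convention), with `0 ≤ κ ≤ |v|` (Lagrange's identity) and `κ` measurable.
* `ChaeLee2017.integral_mul_mul_le_rpow` — Hölder with three factors, the first merely bounded
  measurable: `∫ κ f b ≤ ‖κ‖_γ ‖f‖_{2γ/(γ−2)} ‖b‖₂`.
* `ChaeLee2017.integral_inner_convect_laplacian_le_of_depletion`,
  `ChaeLee2017.exists_enstrophyFlux_le_of_depletion` — for ANY bounded measurable `κ ≥ 0` with
  `(ω × v)·Δv ≤ κ|ω||Δv|`: `∫⟪(v·∇)v, Δv⟫ ≤ √2 ∫ κ|∇v||Δv|` and, for `3 < γ < ∞`,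
  `−ν‖Δv‖₂² + ∫⟪(v·∇)v, Δv⟫ ≤ K ‖κ‖_γ^{2γ/(γ−3)} ‖∇v‖₂²` (the tree's Serrin assembly:
  interpolation `2–6`, `‖∇v‖₆ ≤ c‖Δv‖₂`, weighted AM–GM).
* `Torus.classicalNS_continuation_of_lambDepletion_rpow_integral_le` (`3 < γ < ∞`),
  `Torus.exists_classicalNS_continuation_of_lambDepletion_L3_le` (`γ = 3`, smallness),
  `Torus.classicalNS_continuation_of_lambDepletion_sup_sq_integral_le` (`γ = ∞`, `α = 2`) — the
  criterion in DEPLETION-FACTOR form (any admissible `κ`; `κ = |u|` is Serrin's).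
* `Torus.classicalNS_continuation_of_posPart_tripleProduct_rpow_integral_le` — **Thm 1 (ii) at
  `β = 2` on `T³`**, with the printed factor written in a frame `e` (`ωₖ = W_{k⁺k⁺⁺}`,
  `(u × ω)ₖ = u_{k⁺}ω_{k⁺⁺} − u_{k⁺⁺}ω_{k⁺}`);
  `Torus.exists_classicalNS_continuation_of_posPart_tripleProduct_L3_le` — **Thm 1 (i) at
  `β = 2`**; `Torus.classicalNS_continuation_of_posPart_tripleProduct_sup_sq_integral_le` —
  the endpoint `γ = ∞`;
  `Torus.forall_exists_lt_integral_posPartMajorant_of_not_bddAbove_gradNormSq` — the blow-up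
  reading ("`= ∞`" at a blow-up time).

Scope (faithfulness): classical solutions with mean-zero slices of the unforced system on the unit
torus (the paper: ℝ³, `H^{1/2}` local solutions); only `β = 2` (the cases `1 ≤ β < 2` involve the
nonlocal `Λ^β` and are NOT typed); `3/γ + 2/α = 1` exactly (on a bounded interval `< 1` reduces to
it by Hölder in time, not done); `‖ω‖_{L^p}` of the printed chain is traded for `‖∇v‖_{L^p}`
(`|ω| ≤ √2|∇v|` pointwise), costing a factor `√2` inside the inexplicit constants; the LOCAL
criterion for suitable weak solutions (Thm 3, `ε`-regularity) is NOT typed.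
-- TODO(general form): `β ∈ [1, 2)`; whole space; Thm 3.

## Mathlib / tree search

Tree (used): `Torus.exists_integral_gradSq_cube_le_laplacianSq_cube`,
`Torus.integral_rpow_le_interpolate_two_six`, `Torus.classicalNS_continuation_of_enstrophyFlux_le`
(`TorusNSSerrinCriterion` / `TorusNSEnstrophyContinuation`), `torusVorticityTensor`,
`torusVorticitySqAt_eq_sum_sq_of_equiv` (`TorusVorticityTensorTransport`),
`torusVorticitySqAt_le_two_mul_sum_norm_sq` (`ExtremeGrowthVorticityControl`),
`Torus.IsDivFree.laplacian_of_isSmooth` (`TorusClassicalH1Balance`),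
`Torus.fderiv_apply_eq_sum_partialDeriv`, `Torus.fderiv_norm_sq_apply`,
`Torus.integral_fderiv_apply_eq_zero_of_isDivFree` (`TorusCalculusProofs`),
`Torus.classicalNS_not_continuation_of_not_bddAbove_gradNormSq'`
(`TorusClassicalNSMaximalSolution`);
Mathlib `integral_mul_le_Lp_mul_Lq_of_nonneg`, `MemLp.of_bound`, `Integrable.bdd_mul`,
`Real.geom_mean_le_arith_mean2_weighted`. Searched (`lean search`, CRITERIA.md §A):
`Chae|tripleProduct|crossProduct.*laplacian|Lamb.*criterion` — the tree has Serrin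
(`TorusNSSerrinCriterion`), Miller's `v × ω` anisotropic criterion
(`TorusNSAnisotropicVorticityCriterion`) and the Berselli–Córdoba orthogonality criterion
(`TorusNSBerselliCordobaCriterion`), not this one — added here.

## References

* [ChaeLee2017] D. Chae, J. Lee, *On the geometric regularity conditions for the 3D Navier–Stokes
  equations*, Nonlinear Anal. 151 (2017) 265–273, doi:10.1016/j.na.2016.10.024, arXiv:1606.08126 —
  Thm 1 (i), (ii) and proof §2 (held text `paper:arxiv-1606.08126`, chunks 3–5); Remark 2.
* [RobinsonRodrigoSadowskiCUP2016] J. C. Robinson, J. L. Rodrigo, W. Sadowski, *The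
  Three-Dimensional Navier–Stokes Equations*, CUP 2016, Lemma 6.11, Lemma 8.16 (the door and the
  Serrin assembly, via the tree files above).
-/

noncomputable section

open Set MeasureTheory intervalIntegral Filter Real
open scoped InnerProductSpace RealInnerProductSpace Topology ENNReal

namespace Literature.Analysis.FluidPDE

open Literature.Analysis.FunctionSpaces

variable {d : Type*} [Fintype d] [DecidableEq d]

namespace ChaeLee2017

/-! ### §1 The rotation form of the enstrophy production: `⟪(v·∇)v, Δv⟫ = (ω × v)·Δv + v·(∇v)Δv` -/

/-- **Rotation form of the trilinear term against a vector, pointwise.** For a `C¹` field `v` on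
`T^d` and any `z`, `⟪(v·∇)v(x), z⟫ = ∑ᵢⱼ vⱼ Wⱼᵢ zᵢ + ⟪v, (z·∇)v⟫(x)` with `Wⱼᵢ = (∂ⱼv)ᵢ − (∂ᵢv)ⱼ`
(`torusVorticityTensor`); in three dimensions `∑ⱼ vⱼWⱼᵢ = (ω × v)ᵢ`, so this is the identity
`(v·∇)v = ω × v + ∇(½|v|²)` paired with `z`. (Proof device.) [folklore] -/
private theorem inner_convect_eq_sum_add_inner_fderiv {v : UnitAddTorus d → EuclideanSpace ℝ d}
    (hv : Torus.IsContDiff 1 v) (x : UnitAddTorus d) (z : EuclideanSpace ℝ d) :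
    ⟪Torus.convect v v x, z⟫_ℝ =
      ∑ i, ∑ j, v x j * torusVorticityTensor v j i x * z i + ⟪v x, Torus.fderiv v x z⟫_ℝ := by
  have hD : ∀ j, ⟪Torus.partialDeriv j v x, z⟫_ℝ = ∑ i, Torus.partialDeriv j v x i * z i :=
    fun j => by simp [PiLp.inner_apply, mul_comm]
  have hE : ∀ i, ⟪v x, Torus.partialDeriv i v x⟫_ℝ = ∑ j, v x j * Torus.partialDeriv i v x j :=
    fun i => by simp [PiLp.inner_apply, mul_comm]
  have h1 : ⟪Torus.convect v v x, z⟫_ℝ = ∑ j, v x j * ∑ i, Torus.partialDeriv j v x i * z i := by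
    rw [Torus.convect, Torus.fderiv_apply_eq_sum_partialDeriv hv x (v x), sum_inner]
    exact Finset.sum_congr rfl fun j _ => by rw [real_inner_smul_left, hD]
  have h2 : ⟪v x, Torus.fderiv v x z⟫_ℝ = ∑ i, z i * ∑ j, v x j * Torus.partialDeriv i v x j := by
    rw [Torus.fderiv_apply_eq_sum_partialDeriv hv x z, inner_sum]
    exact Finset.sum_congr rfl fun i _ => by rw [real_inner_smul_right, hE]
  rw [h1, h2]
  simp only [torusVorticityTensor, Finset.mul_sum]
  rw [Finset.sum_comm, ← Finset.sum_add_distrib]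
  refine Finset.sum_congr rfl fun i _ => ?_
  rw [← Finset.sum_add_distrib]
  exact Finset.sum_congr rfl fun j _ => by ring

/-- **`∫ ⟪v, (Δv·∇)v⟫ = 0` for smooth divergence-free `v`** (`⟪v, (w·∇)v⟫ = ½(w·∇)|v|²` and
`∫ (w·∇)θ = 0` for divergence-free `w`, here `w = Δv`, divergence-free with `v`).
(Proof device.) [folklore] -/
private theorem integral_inner_convect_laplacian_self_eq_zero
    {v : UnitAddTorus d → EuclideanSpace ℝ d}
    (hv : Torus.IsSmooth v) (hdiv : Torus.IsDivFree v) :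
    ∫ x, ⟪v x, Torus.convect (Torus.laplacian v) v x⟫_ℝ = 0 := by
  have h : ∀ x, ⟪v x, Torus.convect (Torus.laplacian v) v x⟫_ℝ =
      2⁻¹ * Torus.fderiv (fun y => ‖v y‖ ^ 2) x (Torus.laplacian v x) := by
    intro x
    rw [Torus.fderiv_norm_sq_apply (hv.isContDiff (by simp)), Torus.convect]
    ring
  simp_rw [h]
  rw [MeasureTheory.integral_const_mul, Torus.integral_fderiv_apply_eq_zero_of_isDivFree
    hv.laplacian hv.norm_sq (Torus.IsDivFree.laplacian_of_isSmooth hv hdiv), mul_zero]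

/-- **The enstrophy production in rotation (Lamb-vector) form.** For a smooth divergence-free
field `v` on `T^d`: `∫⟪(v·∇)v, Δv⟫ = ∫ ∑ᵢⱼ vⱼ Wⱼᵢ (Δv)ᵢ` (`= ∫ (ω × v)·Δv = ∫ (v × ω)·(−Δv)`;
the gradient part `∇(½|v|²)` of the rotation form is `L²`-orthogonal to the divergence-free `Δv`).
This is the first line of the printed proof, "`½ d/dt‖Λ^{β/2}v‖² + ‖∇Λ^{β/2}v‖² = ∫(v × ω)·Λ^β v`",
at `β = 2`, `Λ²v = −Δv`. [cite: ChaeLee2017, §2, proof of Thm 1 (first display), β = 2] -/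
theorem integral_inner_convect_laplacian_eq {v : UnitAddTorus d → EuclideanSpace ℝ d}
    (hv : Torus.IsSmooth v) (hdiv : Torus.IsDivFree v) :
    ∫ x, ⟪Torus.convect v v x, Torus.laplacian v x⟫_ℝ =
      ∫ x, ∑ i, ∑ j, v x j * torusVorticityTensor v j i x * Torus.laplacian v x i := by
  have hv1 : Torus.IsContDiff 1 v := hv.isContDiff (by simp)
  have hpt : ∀ x, ∑ i, ∑ j, v x j * torusVorticityTensor v j i x * Torus.laplacian v x i =
      ⟪Torus.convect v v x, Torus.laplacian v x⟫_ℝ -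
        ⟪v x, Torus.convect (Torus.laplacian v) v x⟫_ℝ := fun x => by
    rw [inner_convect_eq_sum_add_inner_fderiv hv1 x, Torus.convect]
    ring
  simp_rw [hpt]
  rw [integral_sub ((hv.convect hv).inner hv.laplacian).integrable
    (hv.inner (hv.laplacian.convect hv)).integrable,
    integral_inner_convect_laplacian_self_eq_zero hv hdiv, sub_zero]

/-! ### §2 Pointwise geometry in a frame: `(ω × v)·Δv`, Lagrange's identity, the printed factor -/

omit [Fintype d] [DecidableEq d] in
/-- Addition table of `Fin 3`. (Proof device.) [folklore] -/
private theorem fin3_add :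
    (0 : Fin 3) + 1 = 1 ∧ (0 : Fin 3) + 2 = 2 ∧ (1 : Fin 3) + 1 = 2 ∧ (1 : Fin 3) + 2 = 0 ∧
      (2 : Fin 3) + 1 = 0 ∧ (2 : Fin 3) + 2 = 1 := by
  decide

/-- **`∑ⱼ vⱼ Wⱼᵢ = (ω × v)ᵢ` in a frame**: with `ωₖ = W_{k⁺k⁺⁺}` (`k⁺ = e⁻¹(e k + 1)`,
`k⁺⁺ = e⁻¹(e k + 2)`), `∑ᵢⱼ vⱼ Wⱼᵢ zᵢ = ∑ₖ (ω_{k⁺} v_{k⁺⁺} − ω_{k⁺⁺} v_{k⁺}) zₖ = (ω × v)·z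
= (v × ω)·(−z)`. (Proof device: identifies the frame-free pairing of §1 with the printed triple
product `(v × ω)·Λ²v`, `Λ²v = −Δv`.) [folklore] -/
private theorem sum_sum_mul_vorticityTensor_mul_eq_cross (e : d ≃ Fin 3)
    (v : UnitAddTorus d → EuclideanSpace ℝ d) (x : UnitAddTorus d) (z : EuclideanSpace ℝ d)
    {w : d → ℝ} (hw : ∀ k, w k = torusVorticityTensor v (e.symm (e k + 1)) (e.symm (e k + 2)) x) :
    ∑ i, ∑ j, v x j * torusVorticityTensor v j i x * z i =
      ∑ k, (v x (e.symm (e k + 1)) * w (e.symm (e k + 2)) -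
        v x (e.symm (e k + 2)) * w (e.symm (e k + 1))) * (-z k) := by
  set P : Fin 3 → Fin 3 → ℝ := fun a b => Torus.partialDeriv (e.symm a) v x (e.symm b) with hP
  set U : Fin 3 → ℝ := fun a => v x (e.symm a) with hU
  set Z : Fin 3 → ℝ := fun a => z (e.symm a) with hZ
  have hre : ∀ G : d → ℝ, ∑ j, G j = ∑ b : Fin 3, G (e.symm b) := fun G =>
    Fintype.sum_equiv e _ _ fun j => by simp
  have hW : ∀ b c : Fin 3, torusVorticityTensor v (e.symm b) (e.symm c) x = P b c - P c b := by
    intro b c; simp [hP, torusVorticityTensor]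
  have hwk : ∀ a : Fin 3, w (e.symm a) = P (a + 1) (a + 2) - P (a + 2) (a + 1) := by
    intro a; rw [hw, e.apply_symm_apply, hW]
  have hUU : ∀ a : Fin 3, v x (e.symm a) = U a := fun a => rfl
  have hZZ : ∀ a : Fin 3, z (e.symm a) = Z a := fun a => rfl
  rw [hre]
  simp_rw [hre (fun j => v x j * torusVorticityTensor v j _ x * z _)]
  rw [hre (fun k => (v x (e.symm (e k + 1)) * w (e.symm (e k + 2)) -
        v x (e.symm (e k + 2)) * w (e.symm (e k + 1))) * (-z k))]
  simp only [Equiv.apply_symm_apply, hW, hwk, hUU, hZZ]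
  obtain ⟨h01, h02, h11, h12, h21, h22⟩ := fin3_add
  simp only [Fin.sum_univ_three, h01, h02, h11, h12, h21, h22]
  ring

/-- **`|(ω × v)·z| ≤ |v| |ω| |z|` pointwise** (Cauchy–Schwarz and Lagrange's identity
`|ω × v|² = |ω|²|v|² − (ω·v)²`), for the frame-free pairing: on `T^d`, `card d = 3`,
`|∑ᵢⱼ vⱼ Wⱼᵢ zᵢ| ≤ ‖v(x)‖ · |ω(x)| · ‖z‖` with `|ω|² = torusVorticitySqAt v x`.
(Proof device.) [folklore] -/
private theorem abs_sum_sum_mul_vorticityTensor_mul_le (hd : Fintype.card d = 3)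
    (v : UnitAddTorus d → EuclideanSpace ℝ d) (x : UnitAddTorus d) (z : EuclideanSpace ℝ d) :
    |∑ i, ∑ j, v x j * torusVorticityTensor v j i x * z i| ≤
      ‖v x‖ * Real.sqrt (torusVorticitySqAt v x) * ‖z‖ := by
  obtain ⟨e⟩ : Nonempty (d ≃ Fin 3) := Fintype.card_eq.mp (by simpa using hd)
  set w : d → ℝ := fun k => torusVorticityTensor v (e.symm (e k + 1)) (e.symm (e k + 2)) x
    with hwdef
  have hw : ∀ k, w k = torusVorticityTensor v (e.symm (e k + 1)) (e.symm (e k + 2)) x :=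
    fun k => rfl
  rw [sum_sum_mul_vorticityTensor_mul_eq_cross e v x z hw]
  set P : Fin 3 → Fin 3 → ℝ := fun a b => Torus.partialDeriv (e.symm a) v x (e.symm b) with hP
  set U : Fin 3 → ℝ := fun a => v x (e.symm a) with hU
  set Z : Fin 3 → ℝ := fun a => z (e.symm a) with hZ
  set O : Fin 3 → ℝ := fun a => w (e.symm a) with hO
  have hre : ∀ G : d → ℝ, ∑ j, G j = ∑ b : Fin 3, G (e.symm b) := fun G =>
    Fintype.sum_equiv e _ _ fun j => by simp
  -- the three squared norms in the frame
  have hv2 : ‖v x‖ ^ 2 = ∑ a : Fin 3, U a ^ 2 := by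
    rw [EuclideanSpace.norm_sq_eq, hre]; simp [Real.norm_eq_abs, sq_abs, hU]
  have hz2 : ‖z‖ ^ 2 = ∑ a : Fin 3, Z a ^ 2 := by
    rw [EuclideanSpace.norm_sq_eq, hre]; simp [Real.norm_eq_abs, sq_abs, hZ]
  have ho2 : torusVorticitySqAt v x = ∑ a : Fin 3, O a ^ 2 := by
    rw [torusVorticitySqAt_eq_sum_sq_of_equiv e, hre]
  -- the pairing in the frame
  have hpair : ∑ k, (v x (e.symm (e k + 1)) * w (e.symm (e k + 2)) -
      v x (e.symm (e k + 2)) * w (e.symm (e k + 1))) * (-z k) =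
      ∑ a : Fin 3, (U (a + 1) * O (a + 2) - U (a + 2) * O (a + 1)) * (-Z a) := by
    rw [hre]
    simp only [Equiv.apply_symm_apply, hU, hO, hZ]
  rw [hpair]
  obtain ⟨h01, h02, h11, h12, h21, h22⟩ := fin3_add
  simp only [Fin.sum_univ_three, zero_add, h11, h12, h21, h22] at hv2 hz2 ho2 ⊢
  -- Cauchy–Schwarz and Lagrange: `q² ≤ |U × O|² |Z|² ≤ |U|²|O|²|Z|²`
  set q : ℝ := (U 1 * O 2 - U 2 * O 1) * -Z 0 + (U 2 * O 0 - U 0 * O 2) * -Z 1 +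
    (U 0 * O 1 - U 1 * O 0) * -Z 2 with hq
  have hA0 : 0 ≤ U 0 ^ 2 + U 1 ^ 2 + U 2 ^ 2 := by positivity
  have hB0 : 0 ≤ O 0 ^ 2 + O 1 ^ 2 + O 2 ^ 2 := by positivity
  have hC0 : 0 ≤ Z 0 ^ 2 + Z 1 ^ 2 + Z 2 ^ 2 := by positivity
  have hlag : (U 1 * O 2 - U 2 * O 1) ^ 2 + (U 2 * O 0 - U 0 * O 2) ^ 2 +
      (U 0 * O 1 - U 1 * O 0) ^ 2 ≤
        (U 0 ^ 2 + U 1 ^ 2 + U 2 ^ 2) * (O 0 ^ 2 + O 1 ^ 2 + O 2 ^ 2) := by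
    nlinarith [sq_nonneg (U 0 * O 0 + U 1 * O 1 + U 2 * O 2)]
  have hcs : q ^ 2 ≤ ((U 1 * O 2 - U 2 * O 1) ^ 2 + (U 2 * O 0 - U 0 * O 2) ^ 2 +
      (U 0 * O 1 - U 1 * O 0) ^ 2) * (Z 0 ^ 2 + Z 1 ^ 2 + Z 2 ^ 2) := by
    rw [hq]
    nlinarith [sq_nonneg ((U 1 * O 2 - U 2 * O 1) * Z 1 - (U 2 * O 0 - U 0 * O 2) * Z 0),
      sq_nonneg ((U 1 * O 2 - U 2 * O 1) * Z 2 - (U 0 * O 1 - U 1 * O 0) * Z 0),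
      sq_nonneg ((U 2 * O 0 - U 0 * O 2) * Z 2 - (U 0 * O 1 - U 1 * O 0) * Z 1)]
  have hq2 : q ^ 2 ≤ (U 0 ^ 2 + U 1 ^ 2 + U 2 ^ 2) * (O 0 ^ 2 + O 1 ^ 2 + O 2 ^ 2) *
      (Z 0 ^ 2 + Z 1 ^ 2 + Z 2 ^ 2) :=
    hcs.trans (mul_le_mul_of_nonneg_right hlag hC0)
  have hrhs : ‖v x‖ * Real.sqrt (torusVorticitySqAt v x) * ‖z‖ =
      Real.sqrt ((U 0 ^ 2 + U 1 ^ 2 + U 2 ^ 2) * (O 0 ^ 2 + O 1 ^ 2 + O 2 ^ 2) *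
        (Z 0 ^ 2 + Z 1 ^ 2 + Z 2 ^ 2)) := by
    rw [Real.sqrt_mul (mul_nonneg hA0 hB0), Real.sqrt_mul hA0, ← hv2, ← hz2, ← ho2,
      Real.sqrt_sq (norm_nonneg _), Real.sqrt_sq (norm_nonneg _)]
  rw [hrhs, ← Real.sqrt_sq_eq_abs]
  exact Real.sqrt_le_sqrt hq2

/-- **The printed factor dominates the pairing.** With
`κ(x) := max{0, (v × ω)·(−Δv) / (|ω| |Δv|)}` — the positive part of
`(v × ω/|ω|)·(Λ²v/|Λ²v|)`, `Λ² = −Δ`, with the printed convention that the direction fields are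
`0` where `ω = 0` or `Δv = 0` (Lean's `a/0 = 0`) — one has pointwise
`(v × ω)·(−Δv) ≤ κ · |ω| · |Δv|` (card `d = 3`; frame-free pairing `∑ᵢⱼ vⱼWⱼᵢ(Δv)ᵢ`).
[cite: ChaeLee2017, §2, proof of Thm 1, second display (β = 2)] -/
theorem sum_sum_le_posPart_mul (hd : Fintype.card d = 3)
    (v : UnitAddTorus d → EuclideanSpace ℝ d) (x : UnitAddTorus d) :
    ∑ i, ∑ j, v x j * torusVorticityTensor v j i x * Torus.laplacian v x i ≤
      max 0 ((∑ i, ∑ j, v x j * torusVorticityTensor v j i x * Torus.laplacian v x i) /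
          (Real.sqrt (torusVorticitySqAt v x) * ‖Torus.laplacian v x‖)) *
        Real.sqrt (torusVorticitySqAt v x) * ‖Torus.laplacian v x‖ := by
  set q : ℝ := ∑ i, ∑ j, v x j * torusVorticityTensor v j i x * Torus.laplacian v x i with hq
  set D : ℝ := Real.sqrt (torusVorticitySqAt v x) * ‖Torus.laplacian v x‖ with hD
  have hD0 : 0 ≤ D := by positivity
  rw [mul_assoc, ← hD]
  rcases hD0.eq_or_lt with hD00 | hDpos
  · -- `|ω||Δv| = 0`: then `q = 0` by the Cauchy–Schwarz–Lagrange bound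
    have hq0 : |q| ≤ ‖v x‖ * D := by
      rw [hD, ← mul_assoc]; exact abs_sum_sum_mul_vorticityTensor_mul_le hd v x _
    rw [← hD00, mul_zero] at hq0 ⊢
    exact (abs_nonpos_iff.mp hq0).le
  · calc q = q / D * D := (div_mul_cancel₀ q hDpos.ne').symm
      _ ≤ max 0 (q / D) * D := mul_le_mul_of_nonneg_right (le_max_right _ _) hD0

/-- **The printed factor is at most `|v|`**: `0 ≤ κ(x) ≤ ‖v(x)‖` (so `κ ∈ L^∞` on each time
slice of a classical solution; `κ = |v| · |sin∠(v, ω)| · cos₊∠(v × ω, −Δv)`).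
(Proof device.) [folklore] -/
private theorem posPart_le_norm (hd : Fintype.card d = 3)
    (v : UnitAddTorus d → EuclideanSpace ℝ d) (x : UnitAddTorus d) :
    max 0 ((∑ i, ∑ j, v x j * torusVorticityTensor v j i x * Torus.laplacian v x i) /
        (Real.sqrt (torusVorticitySqAt v x) * ‖Torus.laplacian v x‖)) ≤ ‖v x‖ := by
  set q : ℝ := ∑ i, ∑ j, v x j * torusVorticityTensor v j i x * Torus.laplacian v x i with hq
  set D : ℝ := Real.sqrt (torusVorticitySqAt v x) * ‖Torus.laplacian v x‖ with hD
  have hD0 : 0 ≤ D := by positivity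
  refine max_le (norm_nonneg _) ?_
  have hqD : |q| ≤ ‖v x‖ * D := by
    rw [hD, ← mul_assoc]; exact abs_sum_sum_mul_vorticityTensor_mul_le hd v x _
  rcases hD0.eq_or_lt with hD00 | hDpos
  · rw [← hD00, div_zero]; exact norm_nonneg _
  · rw [div_le_iff₀ hDpos]; exact (le_abs_self q).trans hqD

/-- The frame-free pairing `x ↦ (ω × v)·Δv (x)` is continuous for smooth `v`. (Proof device.)
[folklore] -/
private theorem continuous_sum_sum {v : UnitAddTorus d → EuclideanSpace ℝ d}
    (hv : Torus.IsSmooth v) :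
    Continuous fun x => ∑ i, ∑ j, v x j * torusVorticityTensor v j i x * Torus.laplacian v x i := by
  refine continuous_finsetSum _ fun i _ => continuous_finsetSum _ fun j _ => ?_
  have h1 : Continuous fun x => v x j := (hv.apply j).continuous
  have h2 : Continuous fun x => torusVorticityTensor v j i x :=
    ((hv.partialDeriv j).apply i).continuous.sub ((hv.partialDeriv i).apply j).continuous
  have h3 : Continuous fun x => Torus.laplacian v x i := (hv.laplacian.apply i).continuous
  exact (h1.mul h2).mul h3

/-- The normalisation `x ↦ |ω(x)| |Δv(x)|` is continuous for smooth `v`. (Proof device.)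
[folklore] -/
private theorem continuous_sqrt_vorticitySq_mul_norm_laplacian
    {v : UnitAddTorus d → EuclideanSpace ℝ d}
    (hv : Torus.IsSmooth v) :
    Continuous fun x => Real.sqrt (torusVorticitySqAt v x) * ‖Torus.laplacian v x‖ := by
  have hΩ : Continuous fun x => torusVorticitySqAt v x := by
    unfold torusVorticitySqAt
    refine continuous_const.mul (continuous_finsetSum _ fun i _ =>
      continuous_finsetSum _ fun j _ => ?_)
    exact (((hv.partialDeriv i).apply j).continuous.sub
      ((hv.partialDeriv j).apply i).continuous).pow 2
  exact (Real.continuous_sqrt.comp hΩ).mul hv.laplacian.continuous.norm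

/-- The printed factor `κ` is measurable on each slice (a quotient of continuous functions,
truncated below at `0`). (Proof device.) [folklore] -/
private theorem measurable_posPart {v : UnitAddTorus d → EuclideanSpace ℝ d}
    (hv : Torus.IsSmooth v) :
    Measurable fun x => max 0
      ((∑ i, ∑ j, v x j * torusVorticityTensor v j i x * Torus.laplacian v x i) /
        (Real.sqrt (torusVorticitySqAt v x) * ‖Torus.laplacian v x‖)) :=
  measurable_const.max ((continuous_sum_sum hv).measurable.div
    (continuous_sqrt_vorticitySq_mul_norm_laplacian hv).measurable)


/-! ### §3 Hölder with a bounded measurable factor; the enstrophy-flux bounds -/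

omit [Fintype d] [DecidableEq d] in
/-- A continuous function on the compact torus is bounded. (Proof device.) [folklore] -/
private theorem exists_forall_abs_le {f : UnitAddTorus d → ℝ} (hf : Continuous f) :
    ∃ C, ∀ x, |f x| ≤ C := by
  obtain ⟨C, hC⟩ := isBounded_iff_forall_norm_le.1 (isCompact_range hf).isBounded
  exact ⟨C, fun x => by simpa [Real.norm_eq_abs] using hC (f x) (mem_range_self x)⟩

omit [DecidableEq d] in
/-- **Hölder with three factors, the first merely bounded measurable** (the step
"`≤ ‖{…}₊‖_{L^γ} ‖ω‖_{L^p} ‖Λ^β v‖_{L^q}`, `1/γ + 1/p + 1/q = 1`" of the printed proof, here with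
`q = 2`, `p = 2γ/(γ−2)`): for `κ ≥ 0` bounded and (a.e. strongly) measurable and continuous
`f, b ≥ 0` on `T^d`, `2 < s`,
`∫ κ f b ≤ (∫κ^s)^{1/s} (∫ f^{2s/(s−2)})^{(s−2)/(2s)} (∫ b²)^{1/2}`.
[cite: ChaeLee2017, §2, proof of Thm 1 (Hölder step)] -/
theorem integral_mul_mul_le_rpow {κ f b : UnitAddTorus d → ℝ}
    (hκm : AEStronglyMeasurable κ volume) (hκ0 : ∀ x, 0 ≤ κ x) {B : ℝ} (hκB : ∀ x, κ x ≤ B)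
    (hf : Continuous f) (hb : Continuous b) (hf0 : ∀ x, 0 ≤ f x) (hb0 : ∀ x, 0 ≤ b x)
    {s : ℝ} (hs : 2 < s) :
    ∫ x, κ x * f x * b x ≤
      (∫ x, κ x ^ s) ^ (1 / s) * (∫ x, f x ^ (2 * s / (s - 2))) ^ ((s - 2) / (2 * s)) *
        Real.sqrt (∫ x, b x ^ 2) := by
  have hs0 : 0 < s := by linarith
  have hs2 : 0 < s - 2 := by linarith
  obtain ⟨Cf, hCf⟩ := exists_forall_abs_le hf
  -- `κ f ∈ L²` and `κ² ∈ L^{s/2}` (bounded measurable); `b ∈ L²`, `f² ∈ L^{s/(s−2)}` (continuous)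
  have hκf : MemLp (fun x => κ x * f x) (ENNReal.ofReal 2) volume :=
    MemLp.of_bound (hκm.mul hf.aestronglyMeasurable) (B * Cf) (ae_of_all _ fun x => by
      rw [norm_mul, Real.norm_eq_abs, Real.norm_eq_abs, abs_of_nonneg (hκ0 x)]
      exact mul_le_mul (hκB x) (hCf x) (abs_nonneg _) ((hκ0 x).trans (hκB x)))
  have hb2 : MemLp b (ENNReal.ofReal 2) volume :=
    hb.memLp_of_hasCompactSupport (HasCompactSupport.of_compactSpace b)
  have hCS := integral_mul_le_Lp_mul_Lq_of_nonneg Real.HolderConjugate.two_two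
    (ae_of_all _ fun x => mul_nonneg (hκ0 x) (hf0 x)) (ae_of_all _ hb0) hκf hb2
  have hpq : (s / 2).HolderConjugate (s / (s - 2)) := by
    refine Real.holderConjugate_iff.2 ⟨by linarith, ?_⟩
    field_simp
    ring
  have hκ2m : AEStronglyMeasurable (fun x => κ x ^ 2) volume :=
    (continuous_pow 2).comp_aestronglyMeasurable hκm
  have hκ2 : MemLp (fun x => κ x ^ 2) (ENNReal.ofReal (s / 2)) volume :=
    MemLp.of_bound hκ2m (B ^ 2) (ae_of_all _ fun x => by
      rw [Real.norm_eq_abs, abs_of_nonneg (sq_nonneg _)]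
      exact pow_le_pow_left₀ (hκ0 x) (hκB x) 2)
  have hf2 : MemLp (fun x => f x ^ 2) (ENNReal.ofReal (s / (s - 2))) volume :=
    (hf.pow 2).memLp_of_hasCompactSupport (HasCompactSupport.of_compactSpace _)
  have hH2 := integral_mul_le_Lp_mul_Lq_of_nonneg hpq (ae_of_all _ fun x => sq_nonneg (κ x))
    (ae_of_all _ fun x => sq_nonneg (f x)) hκ2 hf2
  -- rewrite the powers
  have e1 : ∀ x, (κ x * f x) ^ (2 : ℝ) = κ x ^ 2 * f x ^ 2 := fun x => by
    rw [Real.rpow_two]; ring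
  have e2 : ∀ x, (κ x ^ 2) ^ (s / 2) = κ x ^ s := fun x => by
    rw [show (κ x ^ 2 : ℝ) = κ x ^ (2 : ℝ) by rw [Real.rpow_two], ← Real.rpow_mul (hκ0 x)]
    congr 1; ring
  have e3 : ∀ x, (f x ^ 2) ^ (s / (s - 2)) = f x ^ (2 * s / (s - 2)) := fun x => by
    rw [show (f x ^ 2 : ℝ) = f x ^ (2 : ℝ) by rw [Real.rpow_two], ← Real.rpow_mul (hf0 x)]
    congr 1; field_simp
  have e4 : ∀ x, b x ^ (2 : ℝ) = b x ^ 2 := fun x => Real.rpow_two _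
  simp only [e1, e4] at hCS
  simp only [e2, e3] at hH2
  -- assemble
  set A : ℝ := ∫ x, κ x ^ s with hA
  set Fq : ℝ := ∫ x, f x ^ (2 * s / (s - 2)) with hFq
  have hA0 : 0 ≤ A := integral_nonneg fun x => Real.rpow_nonneg (hκ0 x) _
  have hFq0 : 0 ≤ Fq := integral_nonneg fun x => Real.rpow_nonneg (hf0 x) _
  have hB2 : 0 ≤ ∫ x, b x ^ 2 := integral_nonneg fun x => sq_nonneg _
  have hκf0 : 0 ≤ ∫ x, κ x ^ 2 * f x ^ 2 := integral_nonneg fun x => by positivity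
  have h3 : (∫ x, κ x ^ 2 * f x ^ 2) ^ (1 / (2 : ℝ)) ≤ A ^ (1 / s) * Fq ^ ((s - 2) / (2 * s)) := by
    have hmono := Real.rpow_le_rpow hκf0 hH2 (by norm_num : (0 : ℝ) ≤ 1 / 2)
    refine hmono.trans (le_of_eq ?_)
    rw [Real.mul_rpow (Real.rpow_nonneg hA0 _) (Real.rpow_nonneg hFq0 _),
      ← Real.rpow_mul hA0, ← Real.rpow_mul hFq0]
    congr 2
    · field_simp
    · field_simp
  calc ∫ x, κ x * f x * b x
      ≤ (∫ x, κ x ^ 2 * f x ^ 2) ^ (1 / (2 : ℝ)) * (∫ x, b x ^ 2) ^ (1 / (2 : ℝ)) := hCS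
    _ ≤ (A ^ (1 / s) * Fq ^ ((s - 2) / (2 * s))) * (∫ x, b x ^ 2) ^ (1 / (2 : ℝ)) :=
        mul_le_mul_of_nonneg_right h3 (Real.rpow_nonneg hB2 _)
    _ = A ^ (1 / s) * Fq ^ ((s - 2) / (2 * s)) * Real.sqrt (∫ x, b x ^ 2) := by
        rw [Real.sqrt_eq_rpow]

/-- **The production under a depletion factor**: for smooth divergence-free `v` on `T^d` and a
bounded measurable `κ ≥ 0` with `(ω × v)·Δv ≤ κ |ω| |Δv|` pointwise,
`∫⟪(v·∇)v, Δv⟫ ≤ √2 ∫ κ |∇v| |Δv|` (`|∇v| = (∑ⱼ‖∂ⱼv‖²)^{1/2}`; rotation form of §1, the pointwise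
hypothesis, and `|ω| ≤ √2 |∇v|`). (Proof device; the printed chain continues with `‖ω‖_{L^p}`,
here traded for `‖∇v‖_{L^p}` at the cost of `√2`.)
[cite: ChaeLee2017, §2, proof of Thm 1 (second display), β = 2] -/
theorem integral_inner_convect_laplacian_le_of_depletion
    {v : UnitAddTorus d → EuclideanSpace ℝ d} (hv : Torus.IsSmooth v) (hdiv : Torus.IsDivFree v)
    {κ : UnitAddTorus d → ℝ} (hκm : AEStronglyMeasurable κ volume) (hκ0 : ∀ x, 0 ≤ κ x)
    {B : ℝ} (hκB : ∀ x, κ x ≤ B)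
    (hdep : ∀ x, ∑ i, ∑ j, v x j * torusVorticityTensor v j i x * Torus.laplacian v x i ≤
      κ x * Real.sqrt (torusVorticitySqAt v x) * ‖Torus.laplacian v x‖) :
    ∫ x, ⟪Torus.convect v v x, Torus.laplacian v x⟫_ℝ ≤
      Real.sqrt 2 * ∫ x, κ x * Real.sqrt (∑ j, ‖Torus.partialDeriv j v x‖ ^ 2) *
        ‖Torus.laplacian v x‖ := by
  set f : UnitAddTorus d → ℝ := fun x => Real.sqrt (∑ j, ‖Torus.partialDeriv j v x‖ ^ 2) with hf
  set b : UnitAddTorus d → ℝ := fun x => ‖Torus.laplacian v x‖ with hb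
  have hfc : Continuous f := Real.continuous_sqrt.comp
    (continuous_finsetSum _ fun i _ => ((hv.partialDeriv i).continuous.norm).pow 2)
  have hbc : Continuous b := hv.laplacian.continuous.norm
  -- pointwise: `q ≤ κ |ω| |Δv| ≤ √2 κ f b`
  have hpt : ∀ x, ∑ i, ∑ j, v x j * torusVorticityTensor v j i x * Torus.laplacian v x i ≤
      Real.sqrt 2 * (κ x * f x * b x) := by
    intro x
    refine (hdep x).trans ?_
    have hω : Real.sqrt (torusVorticitySqAt v x) ≤ Real.sqrt 2 * f x := by
      rw [hf, ← Real.sqrt_mul (by norm_num : (0 : ℝ) ≤ 2)]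
      exact Real.sqrt_le_sqrt (torusVorticitySqAt_le_two_mul_sum_norm_sq v x)
    have h1 : κ x * Real.sqrt (torusVorticitySqAt v x) * b x ≤ κ x * (Real.sqrt 2 * f x) * b x :=
      mul_le_mul_of_nonneg_right (mul_le_mul_of_nonneg_left hω (hκ0 x)) (norm_nonneg _)
    refine h1.trans (le_of_eq ?_)
    ring
  have hintL : Integrable (fun x => ∑ i, ∑ j, v x j * torusVorticityTensor v j i x *
      Torus.laplacian v x i) volume := (continuous_sum_sum hv).integrable_unitAddTorus
  have hint3 : Integrable (fun x => κ x * (f x * b x)) volume :=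
    ((hfc.mul hbc).integrable_unitAddTorus).bdd_mul hκm (ae_of_all _ fun x => by
      rw [Real.norm_eq_abs, abs_of_nonneg (hκ0 x)]; exact hκB x)
  have hintR : Integrable (fun x => Real.sqrt 2 * (κ x * f x * b x)) volume :=
    (hint3.const_mul (Real.sqrt 2)).congr (ae_of_all _ fun x => by ring)
  rw [integral_inner_convect_laplacian_eq hv hdiv]
  calc ∫ x, ∑ i, ∑ j, v x j * torusVorticityTensor v j i x * Torus.laplacian v x i
      ≤ ∫ x, Real.sqrt 2 * (κ x * f x * b x) := integral_mono hintL hintR hpt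
    _ = Real.sqrt 2 * ∫ x, κ x * f x * b x := MeasureTheory.integral_const_mul _ _

/-- **The enstrophy flux under a depletion factor in `L^s`, `3 < s < ∞`** (the printed chain at
`β = 2`: Hölder, the Gagliardo–Nirenberg interpolations, Young: "`I ≤ C‖{…}₊‖_{L^γ}^{2γ/(γ−3)}
‖Λ^{β/2}v‖²_{L²} + ½‖∇Λ^{β/2}v‖²_{L²}`"): on `T^d`, `card d = 3`, for `3 < s` and `ν > 0` there is
`K ≥ 0` (from the tree's Sobolev constant) such that for every smooth divergence-free `v`, every
bounded measurable `κ ≥ 0` with `(ω × v)·Δv ≤ κ|ω||Δv|` pointwise and `(∫κ^s)^{1/s} ≤ N`, `0 ≤ N`,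
`−ν‖Δv‖₂² + ∫⟪(v·∇)v, Δv⟫ ≤ K · N^{2s/(s−3)} · ‖∇v‖₂²`
(the assembly — interpolation `2–6`, `‖∇v‖₆ ≤ c‖Δv‖₂`, weighted AM–GM — is the tree's, from
`TorusNSSerrinCriterion`). [cite: ChaeLee2017, §2, proof of Thm 1 (β = 2, case (ii))] -/
theorem exists_enstrophyFlux_le_of_depletion (hd : Fintype.card d = 3) {s ν : ℝ} (hs : 3 < s)
    (hν : 0 < ν) :
    ∃ K : ℝ, 0 ≤ K ∧ ∀ (v : UnitAddTorus d → EuclideanSpace ℝ d), Torus.IsSmooth v →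
      Torus.IsDivFree v → ∀ (κ : UnitAddTorus d → ℝ), AEStronglyMeasurable κ volume →
      (∀ x, 0 ≤ κ x) → ∀ B : ℝ, (∀ x, κ x ≤ B) →
      (∀ x, ∑ i, ∑ j, v x j * torusVorticityTensor v j i x * Torus.laplacian v x i ≤
          κ x * Real.sqrt (torusVorticitySqAt v x) * ‖Torus.laplacian v x‖) →
      ∀ N : ℝ, 0 ≤ N → (∫ x, κ x ^ s) ^ (1 / s) ≤ N →
        -ν * (∫ x, ‖Torus.laplacian v x‖ ^ 2) +
            ∫ x, ⟪Torus.convect v v x, Torus.laplacian v x⟫_ℝ ≤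
          K * N ^ (2 * s / (s - 3)) * Torus.gradNormSq v := by
  obtain ⟨C₆, hC₆0, hC₆⟩ := Torus.exists_integral_gradSq_cube_le_laplacianSq_cube (d := d) hd
  have hs0 : 0 < s := by linarith
  have hs2 : 0 < s - 2 := by linarith
  have hs3 : 0 < s - 3 := by linarith
  -- weights and exponents
  set α : ℝ := (s - 3) / (2 * s) with hα
  set β : ℝ := (s + 3) / (2 * s) with hβ
  set r : ℝ := 2 * s / (s - 3) with hr
  have hα0 : 0 < α := by rw [hα]; positivity
  have hβ0 : 0 < β := by rw [hβ]; positivity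
  have hαβ : α + β = 1 := by rw [hα, hβ]; field_simp; ring
  have hαr : α⁻¹ = r := by rw [hα, hr, inv_div]
  have hr0 : 0 < r := by rw [hr]; positivity
  -- the constant (the tree's, times `(√2)^r`)
  set c : ℝ := C₆ ^ (1 / (2 * s)) * Real.sqrt 2 with hc
  have hc0 : 0 ≤ c := by positivity
  set K : ℝ := α * (c ^ r * (ν ^ (β / α))⁻¹) with hK
  have hK0 : 0 ≤ K := by positivity
  refine ⟨K, hK0, fun v hv hdiv κ hκm hκ0 B hκB hdep N hN0 hN => ?_⟩
  -- notation
  set f : UnitAddTorus d → ℝ := fun x => Real.sqrt (∑ j, ‖Torus.partialDeriv j v x‖ ^ 2) with hf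
  set G : ℝ := Torus.gradNormSq v with hGdef
  set P : ℝ := ∫ x, ‖Torus.laplacian v x‖ ^ 2 with hPdef
  have hG0 : 0 ≤ G := Torus.gradNormSq_nonneg _
  have hP0 : 0 ≤ P := integral_nonneg fun x => sq_nonneg _
  have hfc : Continuous f := Real.continuous_sqrt.comp
    (continuous_finsetSum _ fun i _ => ((hv.partialDeriv i).continuous.norm).pow 2)
  have hbc : Continuous fun x => ‖Torus.laplacian v x‖ := hv.laplacian.continuous.norm
  have hf0 : ∀ x, 0 ≤ f x := fun x => Real.sqrt_nonneg _
  have hf2 : ∀ x, f x ^ 2 = ∑ j, ‖Torus.partialDeriv j v x‖ ^ 2 := fun x =>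
    Real.sq_sqrt (Finset.sum_nonneg fun j _ => sq_nonneg _)
  have hG : ∫ x, f x ^ 2 = G := by
    simp only [hf2, hGdef, Torus.gradNormSq]
  have hf6 : ∫ x, f x ^ 6 ≤ C₆ * P ^ 3 := by
    have e : ∀ x, f x ^ 6 = (∑ j, ‖Torus.partialDeriv j v x‖ ^ 2) ^ 3 := fun x => by
      rw [← hf2]; ring
    simp only [e]
    exact hC₆ v hv
  -- Hölder (with the depletion factor) and interpolation
  have hT0 := integral_inner_convect_laplacian_le_of_depletion hv hdiv hκm hκ0 hκB hdep
  have hH := integral_mul_mul_le_rpow hκm hκ0 hκB hfc hbc hf0 (fun x => norm_nonneg _)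
    (by linarith : (2 : ℝ) < s)
  have hI := Torus.integral_rpow_le_interpolate_two_six hs hfc hf0
  rw [hG] at hI
  set Fq : ℝ := ∫ x, f x ^ (2 * s / (s - 2)) with hFq
  have hFq0 : 0 ≤ Fq := integral_nonneg fun x => Real.rpow_nonneg (hf0 x) _
  have hI6 : 0 ≤ ∫ x, f x ^ 6 := integral_nonneg fun x => pow_nonneg (hf0 x) 6
  -- `Fq^{(s-2)/(2s)} ≤ C₆^{1/(2s)} G^α P^{3/(2s)}`
  have hFq_le : Fq ^ ((s - 2) / (2 * s)) ≤ C₆ ^ (1 / (2 * s)) * G ^ α * P ^ (3 / (2 * s)) := by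
    have h1 : Fq ≤ G ^ ((s - 3) / (s - 2)) * (C₆ * P ^ 3) ^ (1 / (s - 2)) := by
      refine hI.trans (mul_le_mul_of_nonneg_left ?_ (Real.rpow_nonneg hG0 _))
      exact Real.rpow_le_rpow hI6 hf6 (by positivity)
    have h2 := Real.rpow_le_rpow hFq0 h1 (by positivity : (0 : ℝ) ≤ (s - 2) / (2 * s))
    refine h2.trans (le_of_eq ?_)
    have hCP : 0 ≤ C₆ * P ^ 3 := by positivity
    rw [Real.mul_rpow (Real.rpow_nonneg hG0 _) (Real.rpow_nonneg hCP _), ← Real.rpow_mul hG0,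
      ← Real.rpow_mul hCP, Real.mul_rpow hC₆0 (by positivity),
      show (P ^ 3 : ℝ) = P ^ (3 : ℝ) by norm_cast, ← Real.rpow_mul hP0]
    have x1 : (s - 3) / (s - 2) * ((s - 2) / (2 * s)) = α := by rw [hα]; field_simp
    have x2 : 1 / (s - 2) * ((s - 2) / (2 * s)) = 1 / (2 * s) := by field_simp
    have x3 : (3 : ℝ) * (1 / (2 * s)) = 3 / (2 * s) := by ring
    rw [x1, x2, x3]
    ring
  -- `T ≤ √2 · N · C₆^{1/(2s)} G^α P^{3/(2s)} · √P = (c N) G^α P^β`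
  have hsqrtP : Real.sqrt P = P ^ (1 / (2 : ℝ)) := Real.sqrt_eq_rpow P
  have hPβ : P ^ (3 / (2 * s)) * P ^ (1 / (2 : ℝ)) = P ^ β := by
    rw [← Real.rpow_add' hP0 (by rw [hβ] at hβ0; positivity)]
    congr 1; rw [hβ]; field_simp; ring
  have hA0 : 0 ≤ (∫ x, κ x ^ s) ^ (1 / s) :=
    Real.rpow_nonneg (integral_nonneg fun x => Real.rpow_nonneg (hκ0 x) _) _
  have hT2 : ∫ x, ⟪Torus.convect v v x, Torus.laplacian v x⟫_ℝ ≤ (c * N) * G ^ α * P ^ β := by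
    refine hT0.trans ?_
    rw [hsqrtP] at hH
    have hstep : (∫ x, κ x ^ s) ^ (1 / s) * Fq ^ ((s - 2) / (2 * s)) * P ^ (1 / (2 : ℝ)) ≤
        N * (C₆ ^ (1 / (2 * s)) * G ^ α * P ^ (3 / (2 * s))) * P ^ (1 / (2 : ℝ)) := by
      refine mul_le_mul_of_nonneg_right ?_ (Real.rpow_nonneg hP0 _)
      exact mul_le_mul hN hFq_le (Real.rpow_nonneg hFq0 _) hN0
    calc Real.sqrt 2 * ∫ x, κ x * f x * ‖Torus.laplacian v x‖
        ≤ Real.sqrt 2 * ((∫ x, κ x ^ s) ^ (1 / s) * Fq ^ ((s - 2) / (2 * s)) *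
            P ^ (1 / (2 : ℝ))) := mul_le_mul_of_nonneg_left hH (Real.sqrt_nonneg _)
      _ ≤ Real.sqrt 2 * (N * (C₆ ^ (1 / (2 * s)) * G ^ α * P ^ (3 / (2 * s))) *
            P ^ (1 / (2 : ℝ))) := mul_le_mul_of_nonneg_left hstep (Real.sqrt_nonneg _)
      _ = (c * N) * G ^ α * (P ^ (3 / (2 * s)) * P ^ (1 / (2 : ℝ))) := by rw [hc]; ring
      _ = (c * N) * G ^ α * P ^ β := by rw [hPβ]
  -- weighted AM–GM: `M G^α P^β ≤ α M^{1/α} ν^{-β/α} G + β ν P` (the tree's assembly)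
  set M : ℝ := c * N with hM
  have hM0 : 0 ≤ M := mul_nonneg hc0 hN0
  set X : ℝ := M ^ r * (ν ^ (β / α))⁻¹ * G with hX
  set Y : ℝ := ν * P with hY
  have hX0 : 0 ≤ X := by positivity
  have hY0 : 0 ≤ Y := by positivity
  have hAMGM := Real.geom_mean_le_arith_mean2_weighted hα0.le hβ0.le hX0 hY0 hαβ
  have hXα : X ^ α = M * (ν ^ β)⁻¹ * G ^ α := by
    rw [hX, Real.mul_rpow (by positivity) hG0, Real.mul_rpow (by positivity) (by positivity),
      Real.inv_rpow (by positivity), ← Real.rpow_mul hν.le, ← hαr,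
      Real.rpow_inv_rpow hM0 hα0.ne']
    congr 2
    rw [div_mul_cancel₀ β hα0.ne']
  have hYβ : Y ^ β = ν ^ β * P ^ β := by rw [hY, Real.mul_rpow hν.le hP0]
  have hprod : X ^ α * Y ^ β = M * G ^ α * P ^ β := by
    rw [hXα, hYβ]
    have hνβ : (ν ^ β)⁻¹ * ν ^ β = 1 := inv_mul_cancel₀ (Real.rpow_pos_of_pos hν β).ne'
    calc M * (ν ^ β)⁻¹ * G ^ α * (ν ^ β * P ^ β)
        = M * ((ν ^ β)⁻¹ * ν ^ β) * G ^ α * P ^ β := by ring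
      _ = M * G ^ α * P ^ β := by rw [hνβ, mul_one]
  rw [hprod] at hAMGM
  have hKX : α * X = K * N ^ r * G := by
    rw [hX, hK, hM, Real.mul_rpow hc0 hN0]
    ring
  have hβ1 : β ≤ 1 := by linarith
  have hβY : β * Y ≤ ν * P := by
    rw [hY]
    exact mul_le_of_le_one_left (by positivity) hβ1
  calc -ν * (∫ x, ‖Torus.laplacian v x‖ ^ 2) + ∫ x, ⟪Torus.convect v v x, Torus.laplacian v x⟫_ℝ
      ≤ -ν * P + M * G ^ α * P ^ β := by rw [hPdef]; linarith [hT2]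
    _ ≤ -ν * P + (α * X + β * Y) := by linarith [hAMGM]
    _ ≤ α * X := by linarith [hβY]
    _ = K * N ^ (2 * s / (s - 3)) * Torus.gradNormSq v := by rw [hKX]

end ChaeLee2017

/-! ### §4 The criteria along classical solutions (depletion-factor form) -/

section Criterion

variable {ν T : ℝ} {u : ℝ → UnitAddTorus d → EuclideanSpace ℝ d} {p : ℝ → UnitAddTorus d → ℝ}

/-- **Geometric Prodi–Serrin criterion on `T³`, depletion-factor form, `3 < γ < ∞`.** Let
`(u, p)` be a classical solution of the unforced Navier–Stokes equations (`ν > 0`) on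
`[0, T) × T^d`, `card d = 3`, `T > 0`, with mean-zero velocity slices. Suppose that on each slice a
bounded measurable `κ(t, ·) ≥ 0` dominates the Lamb–Laplacian pairing,
`(ω × u)·Δu ≤ κ |ω| |Δu|` pointwise (frame-free: `∑ᵢⱼ uⱼWⱼᵢ(Δu)ᵢ ≤ κ √(torusVorticitySqAt) ‖Δu‖`),
and that a continuous `N ≥ 0` has `(∫ κ(t)^γ)^{1/γ} ≤ N(t)` and `∫₀ᵗ N^{2γ/(γ−3)} ≤ I` on `[0, T)`
(`α = 2γ/(γ−3)`, i.e. `3/γ + 2/α = 1`). Then the solution continues to a classical solution with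
mean-zero slices on some `[0, T'] × T^d`, `T' > T`, equal to `u` on `[0, T)`. The printed factor
`κ = {(u × ω/|ω|)·(Λ²u/|Λ²u|)}₊` is one admissible choice
(`Torus.classicalNS_continuation_of_posPart_tripleProduct_rpow_integral_le`); so is `|u|` itself
(Serrin). Proof: `ChaeLee2017.exists_enstrophyFlux_le_of_depletion` is a Grönwall bound with
`g = 2K N^{2γ/(γ−3)}` for the tree's enstrophy door
`Torus.classicalNS_continuation_of_enstrophyFlux_le`.
[cite: ChaeLee2017, Thm 1 (ii) (β = 2; proof §2)] -/
theorem Torus.classicalNS_continuation_of_lambDepletion_rpow_integral_le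
    (hd : Fintype.card d = 3) {s : ℝ} (hν : 0 < ν) (hT : 0 < T) (hs : 3 < s)
    (h : Torus.IsClassicalNSSolutionOn (Ico 0 T) ν 0 u p)
    (hmean : ∀ t ∈ Ico 0 T, Torus.HasZeroMean (u t)) {κ : ℝ → UnitAddTorus d → ℝ}
    (hκm : ∀ t ∈ Ico 0 T, AEStronglyMeasurable (κ t) volume)
    (hκ0 : ∀ t ∈ Ico 0 T, ∀ x, 0 ≤ κ t x) (hκB : ∀ t ∈ Ico 0 T, ∃ B : ℝ, ∀ x, κ t x ≤ B)
    (hdep : ∀ t ∈ Ico 0 T, ∀ x,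
      ∑ i, ∑ j, u t x j * torusVorticityTensor (u t) j i x * Torus.laplacian (u t) x i ≤
        κ t x * Real.sqrt (torusVorticitySqAt (u t) x) * ‖Torus.laplacian (u t) x‖)
    {N : ℝ → ℝ} (hNc : ContinuousOn N (Ico 0 T)) (hN0 : ∀ t ∈ Ico 0 T, 0 ≤ N t)
    (hN : ∀ t ∈ Ico 0 T, (∫ x, κ t x ^ s) ^ (1 / s) ≤ N t)
    {I : ℝ} (hI : ∀ t ∈ Ico 0 T, ∫ τ in (0 : ℝ)..t, N τ ^ (2 * s / (s - 3)) ≤ I) :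
    ∃ T' : ℝ, T < T' ∧ ∃ (u' : ℝ → UnitAddTorus d → EuclideanSpace ℝ d)
      (p' : ℝ → UnitAddTorus d → ℝ), Torus.IsClassicalNSSolutionOn (Icc 0 T') ν 0 u' p' ∧
        (∀ t ∈ Icc 0 T', Torus.HasZeroMean (u' t)) ∧ ∀ t ∈ Ico 0 T, u' t = u t := by
  obtain ⟨K, hK0, hK⟩ := ChaeLee2017.exists_enstrophyFlux_le_of_depletion (d := d) hd hs hν
  have hs3 : 0 < s - 3 := by linarith
  have hr0 : 0 ≤ 2 * s / (s - 3) := by positivity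
  refine Torus.classicalNS_continuation_of_enstrophyFlux_le hd hν hT h hmean
    (g := fun t => 2 * K * N t ^ (2 * s / (s - 3)))
    (continuousOn_const.mul (hNc.rpow_const fun t _ => Or.inr hr0)) (fun t ht => ?_)
    (I := 2 * K * I) (fun t ht => ?_)
  · have hut : Torus.IsSmooth (u t) := h.smooth_velocity.isSmooth_slice ht
    obtain ⟨B, hB⟩ := hκB t ht
    have h1 := hK (u t) hut (h.divFree t ht) (κ t) (hκm t ht) (hκ0 t ht) B hB (hdep t ht) (N t)
      (hN0 t ht) (hN t ht)
    have h2 : K * N t ^ (2 * s / (s - 3)) * Torus.gradNormSq (u t) =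
        2 * K * N t ^ (2 * s / (s - 3)) * (2⁻¹ * Torus.gradNormSq (u t)) := by ring
    linarith
  · rw [intervalIntegral.integral_const_mul]
    exact mul_le_mul_of_nonneg_left (hI t ht) (by positivity)

/-- **Geometric Prodi–Serrin criterion on `T³`, depletion-factor form, smallness at `γ = 3`.**
On `T^d`, `card d = 3`, for every `ν > 0` there is `c > 0` (from `ν` and the tree's Sobolev
constant) such that: a classical mean-zero solution of the unforced equations on `[0, T) × T^d`,
`T > 0`, with a bounded measurable depletion factor `κ(t, ·) ≥ 0` as above
(`(ω × u)·Δu ≤ κ|ω||Δu|`) satisfying `(∫ κ(t)³)^{1/3} ≤ c` for all `t ∈ [0, T)` continues past `T`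
(the flux is then `≤ (√2 c C₆^{1/6} − ν)‖Δu‖₂² ≤ 0`: "`½ d/dt‖Λ^{β/2}v‖² + [1 − C‖{…}₊‖_{L³}]
‖∇Λ^{β/2}v‖² ≤ 0`"). [cite: ChaeLee2017, Thm 1 (i) (β = 2; proof §2)] -/
theorem Torus.exists_classicalNS_continuation_of_lambDepletion_L3_le (hd : Fintype.card d = 3)
    (hν : 0 < ν) :
    ∃ c : ℝ, 0 < c ∧ ∀ {T : ℝ}, 0 < T →
      ∀ {u : ℝ → UnitAddTorus d → EuclideanSpace ℝ d} {p : ℝ → UnitAddTorus d → ℝ},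
        Torus.IsClassicalNSSolutionOn (Ico 0 T) ν 0 u p →
        (∀ t ∈ Ico 0 T, Torus.HasZeroMean (u t)) →
        ∀ {κ : ℝ → UnitAddTorus d → ℝ}, (∀ t ∈ Ico 0 T, AEStronglyMeasurable (κ t) volume) →
        (∀ t ∈ Ico 0 T, ∀ x, 0 ≤ κ t x) → (∀ t ∈ Ico 0 T, ∃ B : ℝ, ∀ x, κ t x ≤ B) →
        (∀ t ∈ Ico 0 T, ∀ x,
          ∑ i, ∑ j, u t x j * torusVorticityTensor (u t) j i x * Torus.laplacian (u t) x i ≤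
            κ t x * Real.sqrt (torusVorticitySqAt (u t) x) * ‖Torus.laplacian (u t) x‖) →
        (∀ t ∈ Ico 0 T, (∫ x, κ t x ^ (3 : ℝ)) ^ (1 / (3 : ℝ)) ≤ c) →
        ∃ T' : ℝ, T < T' ∧ ∃ (u' : ℝ → UnitAddTorus d → EuclideanSpace ℝ d)
          (p' : ℝ → UnitAddTorus d → ℝ), Torus.IsClassicalNSSolutionOn (Icc 0 T') ν 0 u' p' ∧
            (∀ t ∈ Icc 0 T', Torus.HasZeroMean (u' t)) ∧ ∀ t ∈ Ico 0 T, u' t = u t := by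
  obtain ⟨C₆, hC₆0, hC₆⟩ := Torus.exists_integral_gradSq_cube_le_laplacianSq_cube (d := d) hd
  set k : ℝ := C₆ ^ (1 / (6 : ℝ)) with hk
  have hk0 : 0 ≤ k := Real.rpow_nonneg hC₆0 _
  set c : ℝ := ν / (Real.sqrt 2 * k + 1) with hc
  have hden : 0 < Real.sqrt 2 * k + 1 := by positivity
  have hc0 : 0 < c := by positivity
  have hck : Real.sqrt 2 * c * k ≤ ν := by
    have h1 : c * (Real.sqrt 2 * k + 1) = ν := by rw [hc]; field_simp
    nlinarith
  refine ⟨c, hc0, fun {T} hT {u} {p} h hmean {κ} hκm hκ0 hκB hdep hsmall => ?_⟩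
  refine Torus.classicalNS_continuation_of_enstrophyFlux_le hd hν hT h hmean (g := fun _ => 0)
    continuousOn_const (fun t ht => ?_) (I := 0) (fun t ht => by simp)
  have hut : Torus.IsSmooth (u t) := h.smooth_velocity.isSmooth_slice ht
  obtain ⟨B, hB⟩ := hκB t ht
  -- the depletion step and Hölder at `s = 3`
  have hT0 := ChaeLee2017.integral_inner_convect_laplacian_le_of_depletion hut (h.divFree t ht)
    (hκm t ht) (hκ0 t ht) hB (hdep t ht)
  set f : UnitAddTorus d → ℝ :=
    fun x => Real.sqrt (∑ j, ‖Torus.partialDeriv j (u t) x‖ ^ 2) with hf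
  set P : ℝ := ∫ x, ‖Torus.laplacian (u t) x‖ ^ 2 with hPdef
  have hP0 : 0 ≤ P := integral_nonneg fun x => sq_nonneg _
  have hfc : Continuous f := Real.continuous_sqrt.comp
    (continuous_finsetSum _ fun i _ => ((hut.partialDeriv i).continuous.norm).pow 2)
  have hbc : Continuous fun x => ‖Torus.laplacian (u t) x‖ := hut.laplacian.continuous.norm
  have hf0 : ∀ x, 0 ≤ f x := fun x => Real.sqrt_nonneg _
  have hH := ChaeLee2017.integral_mul_mul_le_rpow (hκm t ht) (hκ0 t ht) hB hfc hbc hf0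
    (fun x => norm_nonneg _) (by norm_num : (2 : ℝ) < 3)
  have hf2 : ∀ x, f x ^ 2 = ∑ j, ‖Torus.partialDeriv j (u t) x‖ ^ 2 := fun x =>
    Real.sq_sqrt (Finset.sum_nonneg fun j _ => sq_nonneg _)
  have hf6 : ∫ x, f x ^ 6 ≤ C₆ * P ^ 3 := by
    have e : ∀ x, f x ^ 6 = (∑ j, ‖Torus.partialDeriv j (u t) x‖ ^ 2) ^ 3 := fun x => by
      rw [← hf2]; ring
    simp only [e]
    exact hC₆ (u t) hut
  have hI6 : 0 ≤ ∫ x, f x ^ 6 := integral_nonneg fun x => pow_nonneg (hf0 x) 6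
  -- normalise the exponents `2·3/(3−2) = 6`, `(3−2)/(2·3) = 1/6`
  have e6 : (2 : ℝ) * 3 / (3 - 2) = ((6 : ℕ) : ℝ) := by norm_num
  have e16 : ((3 : ℝ) - 2) / (2 * 3) = 1 / (6 : ℝ) := by norm_num
  rw [e6, e16] at hH
  simp only [Real.rpow_natCast] at hH
  have hsix : (∫ x, f x ^ 6) ^ (1 / (6 : ℝ)) ≤ k * Real.sqrt P := by
    have h1 := Real.rpow_le_rpow hI6 hf6 (by norm_num : (0 : ℝ) ≤ 1 / 6)
    refine h1.trans (le_of_eq ?_)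
    rw [Real.mul_rpow hC₆0 (by positivity), show (P ^ 3 : ℝ) = P ^ (3 : ℝ) by norm_cast,
      ← Real.rpow_mul hP0, Real.sqrt_eq_rpow, hk]
    norm_num
  have hsP : Real.sqrt P * Real.sqrt P = P := Real.mul_self_sqrt hP0
  have hTle : ∫ x, ⟪Torus.convect (u t) (u t) x, Torus.laplacian (u t) x⟫_ℝ ≤
      Real.sqrt 2 * c * k * P := by
    refine hT0.trans ?_
    have hstep : ∫ x, κ t x * f x * ‖Torus.laplacian (u t) x‖ ≤ c * (k * Real.sqrt P) *
        Real.sqrt P := by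
      refine hH.trans ?_
      refine mul_le_mul_of_nonneg_right ?_ (Real.sqrt_nonneg _)
      exact mul_le_mul (hsmall t ht) hsix (Real.rpow_nonneg hI6 _) hc0.le
    calc Real.sqrt 2 * ∫ x, κ t x * f x * ‖Torus.laplacian (u t) x‖
        ≤ Real.sqrt 2 * (c * (k * Real.sqrt P) * Real.sqrt P) :=
          mul_le_mul_of_nonneg_left hstep (Real.sqrt_nonneg _)
      _ = Real.sqrt 2 * c * k * (Real.sqrt P * Real.sqrt P) := by ring
      _ = Real.sqrt 2 * c * k * P := by rw [hsP]
  have hfin : Real.sqrt 2 * c * k * P ≤ ν * P := mul_le_mul_of_nonneg_right hck hP0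
  rw [hPdef] at hTle hfin
  linarith

/-- **Geometric Prodi–Serrin criterion on `T³`, depletion-factor form, the endpoint `γ = ∞`
(`α = 2`).** A classical mean-zero solution of the unforced equations on `[0, T) × T^d`,
`card d = 3`, with `(ω × u)·Δu ≤ κ|ω||Δu|` pointwise, `κ(t, x) ≤ N(t)` for a continuous `N ≥ 0`
with `∫₀ᵗ N² ≤ I` on `[0, T)`, continues past `T` (flux `≤ √2 N ‖∇u‖₂‖Δu‖₂ − ν‖Δu‖₂² ≤
(N²/2ν)‖∇u‖₂²`). [cite: ChaeLee2017, Thm 1 (ii) (β = 2, γ = ∞, α = 2; proof §2)] -/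
theorem Torus.classicalNS_continuation_of_lambDepletion_sup_sq_integral_le
    (hd : Fintype.card d = 3) (hν : 0 < ν) (hT : 0 < T)
    (h : Torus.IsClassicalNSSolutionOn (Ico 0 T) ν 0 u p)
    (hmean : ∀ t ∈ Ico 0 T, Torus.HasZeroMean (u t)) {κ : ℝ → UnitAddTorus d → ℝ}
    (hdep : ∀ t ∈ Ico 0 T, ∀ x,
      ∑ i, ∑ j, u t x j * torusVorticityTensor (u t) j i x * Torus.laplacian (u t) x i ≤
        κ t x * Real.sqrt (torusVorticitySqAt (u t) x) * ‖Torus.laplacian (u t) x‖)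
    {N : ℝ → ℝ} (hNc : ContinuousOn N (Ico 0 T)) (hN0 : ∀ t ∈ Ico 0 T, 0 ≤ N t)
    (hκN : ∀ t ∈ Ico 0 T, ∀ x, κ t x ≤ N t)
    {I : ℝ} (hI : ∀ t ∈ Ico 0 T, ∫ τ in (0 : ℝ)..t, N τ ^ 2 ≤ I) :
    ∃ T' : ℝ, T < T' ∧ ∃ (u' : ℝ → UnitAddTorus d → EuclideanSpace ℝ d)
      (p' : ℝ → UnitAddTorus d → ℝ), Torus.IsClassicalNSSolutionOn (Icc 0 T') ν 0 u' p' ∧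
        (∀ t ∈ Icc 0 T', Torus.HasZeroMean (u' t)) ∧ ∀ t ∈ Ico 0 T, u' t = u t := by
  refine Torus.classicalNS_continuation_of_enstrophyFlux_le hd hν hT h hmean
    (g := fun t => N t ^ 2 / ν) ((hNc.pow 2).div_const ν) (fun t ht => ?_)
    (I := I / ν) (fun t ht => ?_)
  · have hut : Torus.IsSmooth (u t) := h.smooth_velocity.isSmooth_slice ht
    set f : UnitAddTorus d → ℝ :=
      fun x => Real.sqrt (∑ j, ‖Torus.partialDeriv j (u t) x‖ ^ 2) with hf
    set b : UnitAddTorus d → ℝ := fun x => ‖Torus.laplacian (u t) x‖ with hb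
    set G : ℝ := Torus.gradNormSq (u t) with hGdef
    set P : ℝ := ∫ x, ‖Torus.laplacian (u t) x‖ ^ 2 with hPdef
    have hG0 : 0 ≤ G := Torus.gradNormSq_nonneg _
    have hP0 : 0 ≤ P := integral_nonneg fun x => sq_nonneg _
    have hfc : Continuous f := Real.continuous_sqrt.comp
      (continuous_finsetSum _ fun i _ => ((hut.partialDeriv i).continuous.norm).pow 2)
    have hbc : Continuous b := hut.laplacian.continuous.norm
    have hf0 : ∀ x, 0 ≤ f x := fun x => Real.sqrt_nonneg _
    have hb0 : ∀ x, 0 ≤ b x := fun x => norm_nonneg _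
    have hf2 : ∀ x, f x ^ 2 = ∑ j, ‖Torus.partialDeriv j (u t) x‖ ^ 2 := fun x =>
      Real.sq_sqrt (Finset.sum_nonneg fun j _ => sq_nonneg _)
    have hG : ∫ x, f x ^ 2 = G := by simp only [hf2, hGdef, Torus.gradNormSq]
    -- pointwise: `q ≤ κ|ω||Δu| ≤ N √2 f b`
    have hpt : ∀ x, ∑ i, ∑ j, u t x j * torusVorticityTensor (u t) j i x *
        Torus.laplacian (u t) x i ≤ N t * Real.sqrt 2 * (f x * b x) := by
      intro x
      refine (hdep t ht x).trans ?_
      have hω : Real.sqrt (torusVorticitySqAt (u t) x) ≤ Real.sqrt 2 * f x := by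
        rw [hf, ← Real.sqrt_mul (by norm_num : (0 : ℝ) ≤ 2)]
        exact Real.sqrt_le_sqrt (torusVorticitySqAt_le_two_mul_sum_norm_sq (u t) x)
      have hD0 : 0 ≤ Real.sqrt (torusVorticitySqAt (u t) x) * b x := by positivity
      calc κ t x * Real.sqrt (torusVorticitySqAt (u t) x) * b x
          = κ t x * (Real.sqrt (torusVorticitySqAt (u t) x) * b x) := by ring
        _ ≤ N t * (Real.sqrt (torusVorticitySqAt (u t) x) * b x) :=
            mul_le_mul_of_nonneg_right (hκN t ht x) hD0
        _ ≤ N t * (Real.sqrt 2 * f x * b x) := by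
            refine mul_le_mul_of_nonneg_left ?_ (hN0 t ht)
            exact mul_le_mul_of_nonneg_right hω (hb0 x)
        _ = N t * Real.sqrt 2 * (f x * b x) := by ring
    have hintL : Integrable (fun x => ∑ i, ∑ j, u t x j * torusVorticityTensor (u t) j i x *
        Torus.laplacian (u t) x i) volume :=
      (ChaeLee2017.continuous_sum_sum hut).integrable_unitAddTorus
    have hintR : Integrable (fun x => N t * Real.sqrt 2 * (f x * b x)) volume :=
      ((hfc.mul hbc).integrable_unitAddTorus).const_mul _
    -- Cauchy–Schwarz `∫ f b ≤ √G √P`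
    have hCS : ∫ x, f x * b x ≤ Real.sqrt G * Real.sqrt P := by
      have hf2m : MemLp f (ENNReal.ofReal 2) volume :=
        hfc.memLp_of_hasCompactSupport (HasCompactSupport.of_compactSpace f)
      have hb2m : MemLp b (ENNReal.ofReal 2) volume :=
        hbc.memLp_of_hasCompactSupport (HasCompactSupport.of_compactSpace b)
      have h1 := integral_mul_le_Lp_mul_Lq_of_nonneg Real.HolderConjugate.two_two
        (ae_of_all _ hf0) (ae_of_all _ hb0) hf2m hb2m
      have e1 : ∀ x, f x ^ (2 : ℝ) = f x ^ 2 := fun x => Real.rpow_two _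
      have e2 : ∀ x, b x ^ (2 : ℝ) = b x ^ 2 := fun x => Real.rpow_two _
      simp only [e1, e2] at h1
      rw [hG, ← hPdef, ← Real.sqrt_eq_rpow, ← Real.sqrt_eq_rpow] at h1
      exact h1
    have hT : ∫ x, ⟪Torus.convect (u t) (u t) x, Torus.laplacian (u t) x⟫_ℝ ≤
        N t * Real.sqrt 2 * (Real.sqrt G * Real.sqrt P) := by
      rw [ChaeLee2017.integral_inner_convect_laplacian_eq hut (h.divFree t ht)]
      calc ∫ x, ∑ i, ∑ j, u t x j * torusVorticityTensor (u t) j i x * Torus.laplacian (u t) x i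
          ≤ ∫ x, N t * Real.sqrt 2 * (f x * b x) := integral_mono hintL hintR hpt
        _ = N t * Real.sqrt 2 * ∫ x, f x * b x := MeasureTheory.integral_const_mul _ _
        _ ≤ N t * Real.sqrt 2 * (Real.sqrt G * Real.sqrt P) :=
            mul_le_mul_of_nonneg_left hCS (mul_nonneg (hN0 t ht) (Real.sqrt_nonneg _))
    -- Young: `N √2 √G √P ≤ ν P + N² G/(2ν)`
    have hyoung : N t * Real.sqrt 2 * (Real.sqrt G * Real.sqrt P) ≤
        ν * P + N t ^ 2 / ν * (2⁻¹ * G) := by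
      set x : ℝ := N t * Real.sqrt 2 * Real.sqrt G with hx
      set y : ℝ := Real.sqrt P with hy
      have hx2 : x ^ 2 = 2 * N t ^ 2 * G := by
        rw [hx, mul_pow, mul_pow, Real.sq_sqrt (by norm_num : (0 : ℝ) ≤ 2), Real.sq_sqrt hG0]
        ring
      have hy2 : y ^ 2 = P := by rw [hy, Real.sq_sqrt hP0]
      have h4 : 4 * ν * (x * y) ≤ x ^ 2 + 4 * ν ^ 2 * y ^ 2 := by
        nlinarith [sq_nonneg (x - 2 * ν * y)]
      rw [hx2, hy2] at h4
      have hν4 : 0 < 4 * ν := by positivity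
      have h5 : x * y ≤ (2 * N t ^ 2 * G + 4 * ν ^ 2 * P) / (4 * ν) := by
        rw [le_div_iff₀ hν4]; linarith
      calc N t * Real.sqrt 2 * (Real.sqrt G * Real.sqrt P) = x * y := by rw [hx, hy]; ring
        _ ≤ (2 * N t ^ 2 * G + 4 * ν ^ 2 * P) / (4 * ν) := h5
        _ = ν * P + N t ^ 2 / ν * (2⁻¹ * G) := by field_simp; ring
    rw [hPdef] at hT hyoung
    linarith
  · rw [intervalIntegral.integral_div]
    exact div_le_div_of_nonneg_right (hI t ht) hν.le

end Criterion

/-! ### §5 The printed forms: `κ = {(u × ω/|ω|)·(Λ²u/|Λ²u|)}₊`, `Λ² = −Δ`, in a frame -/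

namespace ChaeLee2017

/-- The printed factor, written with the cross product in a frame `e` (`ωₖ = W_{k⁺k⁺⁺}`,
`(u × ω)ₖ = u_{k⁺}ω_{k⁺⁺} − u_{k⁺⁺}ω_{k⁺}`, `|ω|² = ∑ₖωₖ²`), equals the frame-free factor of §4.
(Proof device.) [folklore] -/
private theorem posPart_frame_eq (e : d ≃ Fin 3) (v : UnitAddTorus d → EuclideanSpace ℝ d)
    (x : UnitAddTorus d) {w : d → ℝ}
    (hw : ∀ k, w k = torusVorticityTensor v (e.symm (e k + 1)) (e.symm (e k + 2)) x) :
    max 0 ((∑ k, (v x (e.symm (e k + 1)) * w (e.symm (e k + 2)) -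
        v x (e.symm (e k + 2)) * w (e.symm (e k + 1))) * (-Torus.laplacian v x k)) /
        (Real.sqrt (∑ k, w k ^ 2) * ‖Torus.laplacian v x‖)) =
      max 0 ((∑ i, ∑ j, v x j * torusVorticityTensor v j i x * Torus.laplacian v x i) /
        (Real.sqrt (torusVorticitySqAt v x) * ‖Torus.laplacian v x‖)) := by
  rw [← sum_sum_mul_vorticityTensor_mul_eq_cross e v x _ hw,
    torusVorticitySqAt_eq_sum_sq_of_equiv e]
  simp only [hw]

end ChaeLee2017

section Printed

variable {ν T : ℝ} {u : ℝ → UnitAddTorus d → EuclideanSpace ℝ d} {p : ℝ → UnitAddTorus d → ℝ}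

/-- **Chae–Lee's geometric Prodi–Serrin criterion on `T³` (Thm 1 (ii) at `β = 2`), continuation
form.** Printed (ℝ³, `v₀ ∈ H^{1/2}`, local-in-time regular solution): "`v` blows up at `T_*` … if
and only if for all `γ ∈ (3, ∞]` and `α ∈ [2, ∞]` with `3/γ + 2/α ≤ 1` and all `β ∈ [1, 2]`,
`‖{(v × ω/|ω|)·(Λ^β v/|Λ^β v|)}₊‖_{L^{γ,α}_{x,t}(Q_T)} = ∞`" (direction fields set to `0` where
`ω = 0` or `Λ^β v = 0`). Here, on the unit torus `T^d` (`card d = 3` via a frame `e`), at `β = 2`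
(`Λ²u = −Δu = ∇ × ω`, `Torus.curl_curl_eq_neg_laplacian_of_isDivFree`), `3 < γ < ∞`,
`α = 2γ/(γ−3)`: let `(u, p)` be a classical solution of the unforced Navier–Stokes equations
(`ν > 0`) on `[0, T) × T^d`, `T > 0`, with mean-zero velocity slices, `ωₖ = W_{k⁺k⁺⁺}(u(t))`, and
`κ(t,x) := max{0, (u × ω)·(−Δu) / (|ω| |Δu|)}`; if a continuous `N ≥ 0` has
`(∫ κ(t)^γ dx)^{1/γ} ≤ N(t)` and `∫₀ᵗ N^{2γ/(γ−3)} ≤ I` on `[0, T)`, then the solution continues to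
a classical solution with mean-zero slices on some `[0, T'] × T^d`, `T' > T`, equal to `u` on
`[0, T)` — `T` is not a blow-up time. (For Beltrami slices `u × ω = 0` the factor vanishes
identically, Remark 2.) Proof: the printed one (§2) — `κ` is an admissible depletion factor
(`ChaeLee2017.sum_sum_le_posPart_mul`, bounded by `|u|`, measurable) for
`Torus.classicalNS_continuation_of_lambDepletion_rpow_integral_le`.
[cite: ChaeLee2017, Thm 1 (ii) (β = 2, 3 < γ < ∞; proof §2)] -/
theorem Torus.classicalNS_continuation_of_posPart_tripleProduct_rpow_integral_le (e : d ≃ Fin 3)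
    {s : ℝ} (hν : 0 < ν) (hT : 0 < T) (hs : 3 < s)
    (h : Torus.IsClassicalNSSolutionOn (Ico 0 T) ν 0 u p)
    (hmean : ∀ t ∈ Ico 0 T, Torus.HasZeroMean (u t)) {w : ℝ → d → UnitAddTorus d → ℝ}
    (hw : ∀ t k x, w t k x = torusVorticityTensor (u t) (e.symm (e k + 1)) (e.symm (e k + 2)) x)
    {N : ℝ → ℝ} (hNc : ContinuousOn N (Ico 0 T)) (hN0 : ∀ t ∈ Ico 0 T, 0 ≤ N t)
    (hN : ∀ t ∈ Ico 0 T, (∫ x, (max 0 ((∑ k, (u t x (e.symm (e k + 1)) * w t (e.symm (e k + 2)) x -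
          u t x (e.symm (e k + 2)) * w t (e.symm (e k + 1)) x) * (-Torus.laplacian (u t) x k)) /
          (Real.sqrt (∑ k, w t k x ^ 2) * ‖Torus.laplacian (u t) x‖))) ^ s) ^ (1 / s) ≤ N t)
    {I : ℝ} (hI : ∀ t ∈ Ico 0 T, ∫ τ in (0 : ℝ)..t, N τ ^ (2 * s / (s - 3)) ≤ I) :
    ∃ T' : ℝ, T < T' ∧ ∃ (u' : ℝ → UnitAddTorus d → EuclideanSpace ℝ d)
      (p' : ℝ → UnitAddTorus d → ℝ), Torus.IsClassicalNSSolutionOn (Icc 0 T') ν 0 u' p' ∧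
        (∀ t ∈ Icc 0 T', Torus.HasZeroMean (u' t)) ∧ ∀ t ∈ Ico 0 T, u' t = u t := by
  have hd : Fintype.card d = 3 := by simpa using Fintype.card_congr e
  have hκeq : ∀ t x, max 0 ((∑ k, (u t x (e.symm (e k + 1)) * w t (e.symm (e k + 2)) x -
          u t x (e.symm (e k + 2)) * w t (e.symm (e k + 1)) x) * (-Torus.laplacian (u t) x k)) /
          (Real.sqrt (∑ k, w t k x ^ 2) * ‖Torus.laplacian (u t) x‖)) =
      max 0 ((∑ i, ∑ j, u t x j * torusVorticityTensor (u t) j i x * Torus.laplacian (u t) x i) /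
        (Real.sqrt (torusVorticitySqAt (u t) x) * ‖Torus.laplacian (u t) x‖)) :=
    fun t x => ChaeLee2017.posPart_frame_eq e (u t) x (fun k => hw t k x)
  refine Torus.classicalNS_continuation_of_lambDepletion_rpow_integral_le hd hν hT hs h hmean
    (κ := fun t x => max 0
      ((∑ i, ∑ j, u t x j * torusVorticityTensor (u t) j i x * Torus.laplacian (u t) x i) /
        (Real.sqrt (torusVorticitySqAt (u t) x) * ‖Torus.laplacian (u t) x‖)))
    (fun t ht => ?_) (fun t _ x => le_max_left _ _) (fun t ht => ?_)
    (fun t _ x => ChaeLee2017.sum_sum_le_posPart_mul hd (u t) x) hNc hN0 (fun t ht => ?_) hI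
  · exact (ChaeLee2017.measurable_posPart
      (h.smooth_velocity.isSmooth_slice ht)).aestronglyMeasurable
  · obtain ⟨C, hC⟩ :=
      ChaeLee2017.exists_forall_abs_le (h.smooth_velocity.isSmooth_slice ht).continuous.norm
    exact ⟨C, fun x => (ChaeLee2017.posPart_le_norm hd (u t) x).trans
      ((le_abs_self _).trans (hC x))⟩
  · have h1 := hN t ht
    simp_rw [hκeq] at h1
    exact h1

/-- **Chae–Lee's criterion on `T³`, Thm 1 (i) at `β = 2`: smallness in `L^∞(0,T; L³)`.**
Printed: "if … for an absolute constant `ε₀` and some `β ∈ [1, 2]`,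
`‖{(v × ω/|ω|)·(Λ^β v/|Λ^β v|)}₊‖_{L^{3,∞}_{x,t}(Q_T)} ≤ ε₀`, then a regular solution `v` exists
beyond `T`". Here (unit torus, `card d = 3` via a frame `e`, `β = 2`): for every `ν > 0` there is
`c > 0` (from `ν` and the torus' Sobolev constant) such that a classical mean-zero solution of the
unforced equations on `[0, T) × T^d`, `T > 0`, with `(∫ κ(t)³)^{1/3} ≤ c` for all `t ∈ [0, T)`
(`κ = max{0, (u × ω)·(−Δu)/(|ω||Δu|)}` as above) continues past `T`.
[cite: ChaeLee2017, Thm 1 (i) (β = 2; proof §2)] -/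
theorem Torus.exists_classicalNS_continuation_of_posPart_tripleProduct_L3_le (e : d ≃ Fin 3)
    (hν : 0 < ν) :
    ∃ c : ℝ, 0 < c ∧ ∀ {T : ℝ}, 0 < T →
      ∀ {u : ℝ → UnitAddTorus d → EuclideanSpace ℝ d} {p : ℝ → UnitAddTorus d → ℝ},
        Torus.IsClassicalNSSolutionOn (Ico 0 T) ν 0 u p →
        (∀ t ∈ Ico 0 T, Torus.HasZeroMean (u t)) →
        ∀ {w : ℝ → d → UnitAddTorus d → ℝ},
        (∀ t k x, w t k x = torusVorticityTensor (u t) (e.symm (e k + 1)) (e.symm (e k + 2)) x) →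
        (∀ t ∈ Ico 0 T, (∫ x, (max 0 ((∑ k, (u t x (e.symm (e k + 1)) * w t (e.symm (e k + 2)) x -
          u t x (e.symm (e k + 2)) * w t (e.symm (e k + 1)) x) * (-Torus.laplacian (u t) x k)) /
          (Real.sqrt (∑ k, w t k x ^ 2) * ‖Torus.laplacian (u t) x‖))) ^ (3 : ℝ)) ^
          (1 / (3 : ℝ)) ≤ c) →
        ∃ T' : ℝ, T < T' ∧ ∃ (u' : ℝ → UnitAddTorus d → EuclideanSpace ℝ d)
          (p' : ℝ → UnitAddTorus d → ℝ), Torus.IsClassicalNSSolutionOn (Icc 0 T') ν 0 u' p' ∧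
            (∀ t ∈ Icc 0 T', Torus.HasZeroMean (u' t)) ∧ ∀ t ∈ Ico 0 T, u' t = u t := by
  have hd : Fintype.card d = 3 := by simpa using Fintype.card_congr e
  obtain ⟨c, hc0, hc⟩ := Torus.exists_classicalNS_continuation_of_lambDepletion_L3_le (d := d) hd hν
  refine ⟨c, hc0, fun {T} hT {u} {p} h hmean {w} hw hsmall => ?_⟩
  have hκeq : ∀ t x, max 0 ((∑ k, (u t x (e.symm (e k + 1)) * w t (e.symm (e k + 2)) x -
          u t x (e.symm (e k + 2)) * w t (e.symm (e k + 1)) x) * (-Torus.laplacian (u t) x k)) /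
          (Real.sqrt (∑ k, w t k x ^ 2) * ‖Torus.laplacian (u t) x‖)) =
      max 0 ((∑ i, ∑ j, u t x j * torusVorticityTensor (u t) j i x * Torus.laplacian (u t) x i) /
        (Real.sqrt (torusVorticitySqAt (u t) x) * ‖Torus.laplacian (u t) x‖)) :=
    fun t x => ChaeLee2017.posPart_frame_eq e (u t) x (fun k => hw t k x)
  refine hc hT h hmean
    (κ := fun t x => max 0
      ((∑ i, ∑ j, u t x j * torusVorticityTensor (u t) j i x * Torus.laplacian (u t) x i) /
        (Real.sqrt (torusVorticitySqAt (u t) x) * ‖Torus.laplacian (u t) x‖)))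
    (fun t ht => ?_) (fun t _ x => le_max_left _ _) (fun t ht => ?_)
    (fun t _ x => ChaeLee2017.sum_sum_le_posPart_mul hd (u t) x) (fun t ht => ?_)
  · exact (ChaeLee2017.measurable_posPart
      (h.smooth_velocity.isSmooth_slice ht)).aestronglyMeasurable
  · obtain ⟨C, hC⟩ :=
      ChaeLee2017.exists_forall_abs_le (h.smooth_velocity.isSmooth_slice ht).continuous.norm
    exact ⟨C, fun x => (ChaeLee2017.posPart_le_norm hd (u t) x).trans
      ((le_abs_self _).trans (hC x))⟩
  · have h1 := hsmall t ht
    simp_rw [hκeq] at h1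
    exact h1

/-- **Chae–Lee's criterion on `T³`, the endpoint `γ = ∞`, `α = 2` of Thm 1 (ii) at `β = 2`.**
A classical mean-zero solution of the unforced equations on `[0, T) × T^d` (`card d = 3` via a frame
`e`), with `κ(t, x) ≤ N(t)` for all `x` (`κ = max{0, (u × ω)·(−Δu)/(|ω||Δu|)}`), `N ≥ 0`
continuous with `∫₀ᵗ N² ≤ I` on `[0, T)`, continues past `T`.
[cite: ChaeLee2017, Thm 1 (ii) (β = 2, γ = ∞, α = 2; proof §2)] -/
theorem Torus.classicalNS_continuation_of_posPart_tripleProduct_sup_sq_integral_le (e : d ≃ Fin 3)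
    (hν : 0 < ν) (hT : 0 < T)
    (h : Torus.IsClassicalNSSolutionOn (Ico 0 T) ν 0 u p)
    (hmean : ∀ t ∈ Ico 0 T, Torus.HasZeroMean (u t)) {w : ℝ → d → UnitAddTorus d → ℝ}
    (hw : ∀ t k x, w t k x = torusVorticityTensor (u t) (e.symm (e k + 1)) (e.symm (e k + 2)) x)
    {N : ℝ → ℝ} (hNc : ContinuousOn N (Ico 0 T)) (hN0 : ∀ t ∈ Ico 0 T, 0 ≤ N t)
    (hN : ∀ t ∈ Ico 0 T, ∀ x, max 0 ((∑ k, (u t x (e.symm (e k + 1)) * w t (e.symm (e k + 2)) x -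
          u t x (e.symm (e k + 2)) * w t (e.symm (e k + 1)) x) * (-Torus.laplacian (u t) x k)) /
          (Real.sqrt (∑ k, w t k x ^ 2) * ‖Torus.laplacian (u t) x‖)) ≤ N t)
    {I : ℝ} (hI : ∀ t ∈ Ico 0 T, ∫ τ in (0 : ℝ)..t, N τ ^ 2 ≤ I) :
    ∃ T' : ℝ, T < T' ∧ ∃ (u' : ℝ → UnitAddTorus d → EuclideanSpace ℝ d)
      (p' : ℝ → UnitAddTorus d → ℝ), Torus.IsClassicalNSSolutionOn (Icc 0 T') ν 0 u' p' ∧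
        (∀ t ∈ Icc 0 T', Torus.HasZeroMean (u' t)) ∧ ∀ t ∈ Ico 0 T, u' t = u t := by
  have hd : Fintype.card d = 3 := by simpa using Fintype.card_congr e
  have hκeq : ∀ t x, max 0 ((∑ k, (u t x (e.symm (e k + 1)) * w t (e.symm (e k + 2)) x -
          u t x (e.symm (e k + 2)) * w t (e.symm (e k + 1)) x) * (-Torus.laplacian (u t) x k)) /
          (Real.sqrt (∑ k, w t k x ^ 2) * ‖Torus.laplacian (u t) x‖)) =
      max 0 ((∑ i, ∑ j, u t x j * torusVorticityTensor (u t) j i x * Torus.laplacian (u t) x i) /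
        (Real.sqrt (torusVorticitySqAt (u t) x) * ‖Torus.laplacian (u t) x‖)) :=
    fun t x => ChaeLee2017.posPart_frame_eq e (u t) x (fun k => hw t k x)
  refine Torus.classicalNS_continuation_of_lambDepletion_sup_sq_integral_le hd hν hT h hmean
    (κ := fun t x => max 0
      ((∑ i, ∑ j, u t x j * torusVorticityTensor (u t) j i x * Torus.laplacian (u t) x i) /
        (Real.sqrt (torusVorticitySqAt (u t) x) * ‖Torus.laplacian (u t) x‖)))
    (fun t _ x => ChaeLee2017.sum_sum_le_posPart_mul hd (u t) x) hNc hN0 (fun t ht x => ?_) hI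
  rw [← hκeq]
  exact hN t ht x

/-- **The blow-up reading of Thm 1 (ii) (β = 2) on `T³`.** If `T` IS a blow-up time of the
classical solution (`‖∇u(t)‖₂` unbounded on `[0, T)`), then for every `3 < γ < ∞` and every
continuous majorant `N ≥ (∫κ(t)^γ)^{1/γ}` the primitive `∫₀ᵗ N^{2γ/(γ−3)}` is unbounded on `[0, T)`
("`‖{…}₊‖_{L^{γ,α}(Q_{T_*})} = ∞`"); from the continuation form and the tree's
`Torus.classicalNS_not_continuation_of_not_bddAbove_gradNormSq'`.
[cite: ChaeLee2017, Thm 1 (ii) (β = 2, 3 < γ < ∞)] -/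
theorem Torus.forall_exists_lt_integral_posPartMajorant_of_not_bddAbove_gradNormSq (e : d ≃ Fin 3)
    {s : ℝ} (hν : 0 < ν) (hT : 0 < T) (hs : 3 < s)
    (h : Torus.IsClassicalNSSolutionOn (Ico 0 T) ν 0 u p)
    (hmean : ∀ t ∈ Ico 0 T, Torus.HasZeroMean (u t)) {w : ℝ → d → UnitAddTorus d → ℝ}
    (hw : ∀ t k x, w t k x = torusVorticityTensor (u t) (e.symm (e k + 1)) (e.symm (e k + 2)) x)
    {N : ℝ → ℝ} (hNc : ContinuousOn N (Ico 0 T)) (hN0 : ∀ t ∈ Ico 0 T, 0 ≤ N t)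
    (hN : ∀ t ∈ Ico 0 T, (∫ x, (max 0 ((∑ k, (u t x (e.symm (e k + 1)) * w t (e.symm (e k + 2)) x -
          u t x (e.symm (e k + 2)) * w t (e.symm (e k + 1)) x) * (-Torus.laplacian (u t) x k)) /
          (Real.sqrt (∑ k, w t k x ^ 2) * ‖Torus.laplacian (u t) x‖))) ^ s) ^ (1 / s) ≤ N t)
    (hbu : ¬BddAbove ((fun t => Torus.gradNormSq (u t)) '' Ico 0 T)) :
    ∀ I : ℝ, ∃ t ∈ Ico 0 T, I < ∫ τ in (0 : ℝ)..t, N τ ^ (2 * s / (s - 3)) := by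
  intro I
  by_contra hcon
  push Not at hcon
  exact Torus.classicalNS_not_continuation_of_not_bddAbove_gradNormSq' hν.le hT h hbu
    (Torus.classicalNS_continuation_of_posPart_tripleProduct_rpow_integral_le e hν hT hs h hmean
      hw hNc hN0 hN hcon)

end Printed

end Literature.Analysis.FluidPDE

end
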